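import Summits.CriticalPhenomena.PercolationContinuityZ3.Theorems.PercNearOneGluingNoHeavyLowerTailSahiE3LroLayers
import Mathlib.Data.Fintype.BigOperators
import Mathlib.Tactic.Linarith
import Mathlib.Tactic.Ring

import HarnessLib
import HarnessLib.Audit

/-!
# `NoHeavyLowerTail` (crux stmt-CriticalPhenomena-4575), Sahi programme P4 (Holley / monotone coupling):
# the dimer OR-step `(x ∧ y) ∨ G`, file 3 — the four fibres of a pattern `(Bool × Bool) × Q`

Support file (cell `prim-l12`, seat P4, generation 14; `--supports stmt-CriticalPhenomena-4575`).  No named facts, no sorries;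
standard axioms; def-free.

Bookkeeping for the dimer OR-step (HOME prim-l12-p4/FROM-prim-l12-p4-gen14-DIMER-REDUCTION.md): a finite set `X` of points of
`(Bool × Bool) × Q` is described by its four SECTIONS `{s | (b, s) ∈ X}`, `b ∈ {tt, tf, ft, ff}`; sums split accordingly
(`sum_fibres`, `sum_fibres_univ`), for the layered weight `ν(b, s) = w_b ν'(s)` the mass is the weighted sum of section masses
(`sum_weight_fibres`), sections of an up-set are up-sets and are nested along the order of `Bool × Bool`
(`isUpperSet_sec`, `sec_subset_sec`), and the sections of `X ∩ U`, `U`, `Uᶜ` for the dimer slot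
`U = {x | x.1 = (true, true) ∨ x.2 ∈ G}` are listed (`sec_dimerSlot`).  Companion of `…SahiE3LroLayers` (two fibres).
-/

namespace Summit.CriticalPhenomena.PercolationContinuityZ3.Theorems.SahiE3DimerLayers

open Finset
open scoped BigOperators

variable {Q : Type*} [Fintype Q] [DecidableEq Q]

/-- The fibre of `X ⊆ (Bool × Bool) × Q` over `b` is the image of its section. [folklore] -/
theorem sum_fibre (X : Finset ((Bool × Bool) × Q)) (b : Bool × Bool) (f : (Bool × Bool) × Q → ℝ) :
    ∑ x ∈ X.filter (fun x => x.1 = b), f x = ∑ s ∈ univ.filter (fun s => (b, s) ∈ X), f (b, s) := by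
  have h : X.filter (fun x => x.1 = b) = (univ.filter fun s => (b, s) ∈ X).image (fun s => (b, s)) := by
    ext ⟨c, s⟩
    simp only [Finset.mem_filter, Finset.mem_image, Finset.mem_univ, true_and, Prod.mk.injEq]
    constructor
    · rintro ⟨hx, rfl⟩; exact ⟨s, hx, rfl, rfl⟩
    · rintro ⟨s', hs', rfl, rfl⟩; exact ⟨hs', rfl⟩
  rw [h, Finset.sum_image (fun a _ b' _ hab => by simpa using hab)]

/-- **Four fibres.**  A sum over `X ⊆ (Bool × Bool) × Q` splits into the sums over its four sections. [folklore] -/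
theorem sum_fibres (X : Finset ((Bool × Bool) × Q)) (f : (Bool × Bool) × Q → ℝ) :
    ∑ x ∈ X, f x = ∑ s ∈ univ.filter (fun s => ((true, true), s) ∈ X), f ((true, true), s)
      + ∑ s ∈ univ.filter (fun s => ((true, false), s) ∈ X), f ((true, false), s)
      + ∑ s ∈ univ.filter (fun s => ((false, true), s) ∈ X), f ((false, true), s)
      + ∑ s ∈ univ.filter (fun s => ((false, false), s) ∈ X), f ((false, false), s) := by
  rw [← Finset.sum_fiberwise X (fun x => x.1) f]
  simp only [sum_fibre, Fintype.sum_prod_type, Fintype.sum_bool]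
  ring

/-- Four fibres of the whole pattern. [folklore] -/
theorem sum_fibres_univ (f : (Bool × Bool) × Q → ℝ) :
    ∑ x, f x = ∑ s, f ((true, true), s) + ∑ s, f ((true, false), s) + ∑ s, f ((false, true), s)
      + ∑ s, f ((false, false), s) := by
  rw [sum_fibres]; simp

/-- Mass of `X` for a layered weight `ν(b, s) = w_b · ν'(s)`. [folklore] -/
theorem sum_weight_fibres {ν' : Q → ℝ} {ν : (Bool × Bool) × Q → ℝ} {wtt wtf wft wff : ℝ}
    (htt : ∀ s, ν ((true, true), s) = wtt * ν' s) (htf : ∀ s, ν ((true, false), s) = wtf * ν' s)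
    (hft : ∀ s, ν ((false, true), s) = wft * ν' s) (hff : ∀ s, ν ((false, false), s) = wff * ν' s)
    (X : Finset ((Bool × Bool) × Q)) :
    ∑ x ∈ X, ν x = wtt * ∑ s ∈ univ.filter (fun s => ((true, true), s) ∈ X), ν' s
      + wtf * ∑ s ∈ univ.filter (fun s => ((true, false), s) ∈ X), ν' s
      + wft * ∑ s ∈ univ.filter (fun s => ((false, true), s) ∈ X), ν' s
      + wff * ∑ s ∈ univ.filter (fun s => ((false, false), s) ∈ X), ν' s := by
  rw [sum_fibres, Finset.mul_sum, Finset.mul_sum, Finset.mul_sum, Finset.mul_sum]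
  simp only [htt, htf, hft, hff]

/-- Total mass of a layered weight. [folklore] -/
theorem sum_weight_univ {ν' : Q → ℝ} {ν : (Bool × Bool) × Q → ℝ} {wtt wtf wft wff : ℝ}
    (htt : ∀ s, ν ((true, true), s) = wtt * ν' s) (htf : ∀ s, ν ((true, false), s) = wtf * ν' s)
    (hft : ∀ s, ν ((false, true), s) = wft * ν' s) (hff : ∀ s, ν ((false, false), s) = wff * ν' s) :
    ∑ x, ν x = (wtt + wtf + wft + wff) * ∑ s, ν' s := by
  rw [sum_fibres_univ]
  simp only [htt, htf, hft, hff, ← Finset.mul_sum]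
  ring

omit [Fintype Q] in
/-- Sections of an intersection. [folklore] -/
theorem sec_inter (X Y : Finset ((Bool × Bool) × Q)) (b : Bool × Bool) [Fintype Q] :
    univ.filter (fun s => (b, s) ∈ X ∩ Y) = univ.filter (fun s => (b, s) ∈ X) ∩ univ.filter (fun s => (b, s) ∈ Y) := by
  ext s; simp

/-- Sections of the dimer slot `U = {x | x.1 = (true,true) ∨ x.2 ∈ G}`, of its complement, and of `X ∩ U`. [this work] -/
theorem sec_dimerSlot (G : Finset Q) (U : Finset ((Bool × Bool) × Q))
    (hU : ∀ x, x ∈ U ↔ (x.1 = (true, true) ∨ x.2 ∈ G)) (X : Finset ((Bool × Bool) × Q)) :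
    univ.filter (fun s => ((true, true), s) ∈ X ∩ U) = univ.filter (fun s => ((true, true), s) ∈ X) ∧
    univ.filter (fun s => ((true, false), s) ∈ X ∩ U) = univ.filter (fun s => ((true, false), s) ∈ X) ∩ G ∧
    univ.filter (fun s => ((false, true), s) ∈ X ∩ U) = univ.filter (fun s => ((false, true), s) ∈ X) ∩ G ∧
    univ.filter (fun s => ((false, false), s) ∈ X ∩ U) = univ.filter (fun s => ((false, false), s) ∈ X) ∩ G ∧
    univ.filter (fun s => ((true, true), s) ∈ U) = univ ∧
    univ.filter (fun s => ((true, false), s) ∈ U) = G ∧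
    univ.filter (fun s => ((false, true), s) ∈ U) = G ∧
    univ.filter (fun s => ((false, false), s) ∈ U) = G ∧
    univ.filter (fun s => ((true, true), s) ∈ Uᶜ) = ∅ ∧
    univ.filter (fun s => ((true, false), s) ∈ Uᶜ) = Gᶜ ∧
    univ.filter (fun s => ((false, true), s) ∈ Uᶜ) = Gᶜ ∧
    univ.filter (fun s => ((false, false), s) ∈ Uᶜ) = Gᶜ := by
  refine ⟨?_, ?_, ?_, ?_, ?_, ?_, ?_, ?_, ?_, ?_, ?_, ?_⟩ <;> ext s <;> simp [hU]

variable [PartialOrder Q]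

omit [Fintype Q] [DecidableEq Q] in
/-- An up-set of `(Bool × Bool) × Q` (product order) is closed under raising the `Bool × Bool` coordinate. [folklore] -/
theorem mem_of_mem_of_le {S : Finset ((Bool × Bool) × Q)} (hS : IsUpperSet (S : Set ((Bool × Bool) × Q)))
    {b b' : Bool × Bool} (hbb' : b ≤ b') {s : Q} (h : (b, s) ∈ S) : (b', s) ∈ S :=
  hS (show ((b, s) : (Bool × Bool) × Q) ≤ (b', s) from ⟨hbb', le_rfl⟩) h

/-- The sections of an up-set are up-sets of `Q`. [folklore] -/
theorem isUpperSet_sec {S : Finset ((Bool × Bool) × Q)} (hS : IsUpperSet (S : Set ((Bool × Bool) × Q)))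
    (b : Bool × Bool) : IsUpperSet ((univ.filter (fun s => (b, s) ∈ S) : Finset Q) : Set Q) := by
  intro s s' hss' hs
  simp only [Finset.coe_filter, Finset.mem_univ, true_and, Set.mem_setOf_eq] at hs ⊢
  exact hS (show ((b, s) : (Bool × Bool) × Q) ≤ (b, s') from ⟨le_rfl, hss'⟩) hs

/-- The sections of an up-set are nested along the order of `Bool × Bool`. [folklore] -/
theorem sec_subset_sec {S : Finset ((Bool × Bool) × Q)} (hS : IsUpperSet (S : Set ((Bool × Bool) × Q)))
    {b b' : Bool × Bool} (hbb' : b ≤ b') :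
    univ.filter (fun s => (b, s) ∈ S) ⊆ univ.filter (fun s => (b', s) ∈ S) := by
  intro s hs
  simp only [Finset.mem_filter, Finset.mem_univ, true_and] at hs ⊢
  exact mem_of_mem_of_le hS hbb' hs

/-- The six nestings of the sections of an up-set: `ff ⊆ tf, ft ⊆ tt` and `ff ⊆ tt`. [folklore] -/
theorem sec_nested {S : Finset ((Bool × Bool) × Q)} (hS : IsUpperSet (S : Set ((Bool × Bool) × Q))) :
    univ.filter (fun s => ((false, false), s) ∈ S) ⊆ univ.filter (fun s => ((true, false), s) ∈ S) ∧
    univ.filter (fun s => ((false, false), s) ∈ S) ⊆ univ.filter (fun s => ((false, true), s) ∈ S) ∧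
    univ.filter (fun s => ((true, false), s) ∈ S) ⊆ univ.filter (fun s => ((true, true), s) ∈ S) ∧
    univ.filter (fun s => ((false, true), s) ∈ S) ⊆ univ.filter (fun s => ((true, true), s) ∈ S) ∧
    univ.filter (fun s => ((false, false), s) ∈ S) ⊆ univ.filter (fun s => ((true, true), s) ∈ S) := by
  refine ⟨sec_subset_sec hS ⟨Bool.false_le _, le_rfl⟩, sec_subset_sec hS ⟨le_rfl, Bool.false_le _⟩,
    sec_subset_sec hS ⟨le_rfl, Bool.false_le _⟩, sec_subset_sec hS ⟨Bool.false_le _, le_rfl⟩,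
    sec_subset_sec hS ⟨Bool.false_le _, Bool.false_le _⟩⟩

end Summit.CriticalPhenomena.PercolationContinuityZ3.Theorems.SahiE3DimerLayers
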